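import Summits.HodgeConjecture.HodgeConjecture.Theorems.H413RallisTransport
import HarnessLib

/-!
# FLOOR-0 P4, seat J-R (sequel) — THE CONSUMPTION FORM of the Rallis→model transport at the line:
# S6's theta lift of `f` versus the model's slot-0 lift of the twisted pull-back `(f ∘ a) · κ`

Cell hodgecm-mathlib (D-0151), FLOOR 0, crux item H413 = stmt-HodgeConjecture-24833; programme P4, line
`Cruxes/H413/Lines/F0_P4AdmissibleOccursInH1.lean`, stub S4′ (road (ii-β)).  Author F0P4-p05 (g0).  Sequel of
`Theorems/H413RallisTransport.lean` (same binders, same namespace); `--supports stmt-HodgeConjecture-24833` (helper).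

WHAT IS HERE (kernel; the generic engine is ★ `Weil1964/ThetaLiftTransportAdelic` §4 `thetaLift_comp_mul_ne_zero_iff_of_twist`):

* **`kernelDatum_thetaLift_comp_mul_ne_zero_iff`** — for every model pair datum `P` on `↥(regimeSubgroup L V.Hm) × relNormOneIdeles`
  with `P.ω = lineRepOf … 0`, `P.ΓU = regimeRat`, every finite `μ′` on `[U(1)]`, every `Φ ∈ 𝒮(𝔸_{L⁺}³)`, every
  `f ∈ C([U(⟨a₀⟩)])` and the continuous multiplier `κ` on `[U(1)]` descending `t ↦ η₀(1, t♭) · χ₀(1, e t)`: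
  `P.kernelDatum.thetaLift μ′ Φ ((f ∘ a) · κ) ≠ 0 ↔ (cmThetaKernelDatum … hGR₀ hρ SK hSK).thetaLift (μ′.map a) Φ f ≠ 0`, `a = cosetCongr e`
  — so ANY non-vanishing theorem for S6's datum `UnitaryDualPair.thetaKernelDatum L⁺ L c 3 1 e₁ (diagonal (frameD V))
  (diagonal (lineVec (dW S 0))) … (splittingOf hGR₀) …` (★ p789496 + ★ `thetaLift_charCM_tmul_ne_zero_of_finCoeff_ne_zero`, …)
  gives a non-vanishing slot-0 MODEL lift, with an explicit test function;
* **`exists_kappa`** — `κ` exists as soon as `t ↦ η₀(1, t♭) · χ₀(1, e t)` is continuous (at the pin: the side's `hη₀c` and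
  ★ `continuous_cmLineChar₀_of_signs`, along ★ `continuous_cmLineTorusEquiv`); it is AUTOMORPHIC by ★ `RallisTransport.twist_eq_one`;
* **S6's `μ`-binders for `μ′.map a`**: `smulInvariantMeasure_map_cosetCongr` (invariant), `isOpenPosMeasure_map_cosetCongr'`
  (open-positive); finiteness is Mathlib's instance `Measure.isFiniteMeasure_map`.

NOT here: the identification of `((charCM χ̃) ∘ a) · κ` with the model's `charInv χ` for the character `χ` the line's distribution
`D.dist` integrates against — the χ-bookkeeping of junction J (F0P4-p01; ★ `Liu2021.Def411ChiAutomorphicQuotient.chiQuot` of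
F0P4-p02 is the `χ̃`).  HC_CM is proved only modulo the printed citations until rung 0 closes; this file proves nothing about them.

## References (conventions only; nothing of print is asserted)
* [Howe1979] R. Howe, *θ-series and invariant theory*, Proc. Sympos. Pure Math. 33.1 (1979), §3.
* [GelbartRogawski1991] S. Gelbart, J. Rogawski, Invent. Math. 105 (1991), §3.1 Remark p. 457 L4–13.
* [Li1992] J.-S. Li, J. reine angew. Math. 428 (1992), Thm 2.1 (26) p. 184, p. 178.
-/

set_option autoImplicit false
set_option linter.dupNamespace false

noncomputable section

open _root_.MeasureTheory
open NumberField hiding relNormOneIdeles relNormOneRat probHaarRelNormOneQuot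
open scoped Matrix
open Literature.NumberTheory.Automorphic Literature.NumberTheory.Automorphic.UnitaryGroup Literature.NumberTheory.Weil1964
open Literature.NumberTheory.Weil1964.ThetaKernelDatum
open Literature.NumberTheory.GelbartRogawski1991 Literature.NumberTheory.GelbartRogawski1991.UnitaryDualPair
open Literature.MeasureTheory.Group
open HodgeCM HodgeCM.Adelic HodgeCM.PerL34 HodgeCM.Model HodgeCM.Model.ArchSideTerm HodgeCM.Model.SupplyResidual

namespace Summit.HodgeConjecture.HodgeConjecture.Cruxes.H413.RallisTransport

variable {L : CMField} {ι₁ : L →+* ℂ} (V : HermSpace3 L ι₁) (S : StubTree.SeesawDatum L)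
variable
  (hGR : (cmSplittingDatum (L : Type) finProdFinEquiv (frameD V) (frameD_real V) (frameD_ne V) (dW S) (dW_real S) (dW_ne S)).CompatibleSplitting)
  (hGR₀ : (cmSplittingDatum (L : Type) (e₁) (frameD V) (frameD_real V) (frameD_ne V) (lineVec (L : Type) (dW S 0))
    (fun _ => dW_real S 0) (fun _ => dW_ne S 0)).CompatibleSplitting)
  (hGR₁ : (cmSplittingDatum (L : Type) (e₁) (frameD V) (frameD_real V) (frameD_ne V) (lineVec (L : Type) (dW S 1))
    (fun _ => dW_real S 1) (fun _ => dW_ne S 1)).CompatibleSplitting)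
  (hGR₂ : (cmSplittingDatum (L : Type) (e₁) (frameD V) (frameD_real V) (frameD_ne V) (lineVec (L : Type) (dW' S 0))
    (fun _ => dW'_real S 0) (fun _ => dW'_ne S 0)).CompatibleSplitting)
  (hGR₃ : (cmSplittingDatum (L : Type) (e₁) (frameD V) (frameD_real V) (frameD_ne V) (lineVec (L : Type) (dW' S 1))
    (fun _ => dW'_real S 1) (fun _ => dW'_ne S 1)).CompatibleSplitting)
  (η₀ η₁ η₂ η₃ : CMAdelic (L : Type) (frameD V) × CMAdelicOne (L : Type) →* ℂˣ)
  (eU : ↥(regimeSubgroup L V.Hm) ≃* CMAdelic (L : Type) (frameD V))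
  (heU : ∀ x : ↥(regimeSubgroup L V.Hm),
    eU x = cmFrameEquiv (L : Type) (frameG V) V.Hm (frameD V) (frame_congr V) (x : ↥(HodgeCM.Adelic.adelicUnitaryGroup (L : Type) V.Hm)))
  (e : ↥(relNormOneIdeles (↥(maximalRealSubfield L)) L) ≃* CMAdelic (L : Type) (lineVec (L : Type) (dW S 0)))
  (he : ∀ t : ↥(relNormOneIdeles (↥(maximalRealSubfield L)) L),
    e t = CMCenter (L : Type) (lineVec (L : Type) (dW S 0)) ((cmAdelicOneEquivRelNormOne (L : Type)).symm t))

/-! ## §5 The consumption form: official lift of `f` versus model lift of `(f ∘ a) · κ`; measures; the multiplier `κ` -/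

section Consumption

variable (P : WeilPairData (↥(maximalRealSubfield L)) (L : Type) (Fin 3) ↥(regimeSubgroup L V.Hm))
  (hPω : P.ω = lineRepOf V S hGR hGR₀ hGR₁ hGR₂ hGR₃ η₀ η₁ η₂ η₃ 0) (hPΓ : P.ΓU = regimeRat L V.Hm)
  (hΓ : ∀ t : ↥(relNormOneIdeles (↥(maximalRealSubfield L)) L),
    e t ∈ CMRat (L : Type) (lineVec (L : Type) (dW S 0)) ↔ t ∈ relNormOneRat (↥(maximalRealSubfield L)) L)
  (hρ : HasThetaMajorants fun
    (p : CMAdelic (L : Type) (frameD V) × CMAdelic (L : Type) (lineVec (L : Type) (dW S 0)))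
    (Φ : piSchwartzBruhat (↥(maximalRealSubfield L)) (Fin 3)) =>
      cmPairRep (L : Type) e₁ (frameD V) (frameD_real V) (frameD_ne V) (lineVec (L : Type) (dW S 0))
        (fun _ => dW_real S 0) (fun _ => dW_ne S 0) hGR₀ p Φ)
  (SK : Set (piSchwartzBruhat (↥(maximalRealSubfield L)) (Fin 3)))
  (hSK : ∀ (h : CMAdelic (L : Type) (lineVec (L : Type) (dW S 0))) (Φ : piSchwartzBruhat (↥(maximalRealSubfield L)) (Fin 3)),
    Φ ∈ SK → cmPairRep (L : Type) e₁ (frameD V) (frameD_real V) (frameD_ne V) (lineVec (L : Type) (dW S 0))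
      (fun _ => dW_real S 0) (fun _ => dW_ne S 0) hGR₀ (1, h) Φ ∈ SK)
  [MeasurableSpace (CMAdelic (L : Type) (lineVec (L : Type) (dW S 0)) ⧸ CMRat (L : Type) (lineVec (L : Type) (dW S 0)))]
  [BorelSpace (CMAdelic (L : Type) (lineVec (L : Type) (dW S 0)) ⧸ CMRat (L : Type) (lineVec (L : Type) (dW S 0)))]
  [CompactSpace (CMAdelic (L : Type) (frameD V) ⧸ CMRat (L : Type) (frameD V))]
  [CompactSpace (CMAdelic (L : Type) (lineVec (L : Type) (dW S 0)) ⧸ CMRat (L : Type) (lineVec (L : Type) (dW S 0)))]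
  [CompactSpace (↥(regimeSubgroup L V.Hm) ⧸ P.ΓU)]
  (μ' : Measure (↥(relNormOneIdeles (↥(maximalRealSubfield L)) L) ⧸ relNormOneRat (↥(maximalRealSubfield L)) L))
  [IsFiniteMeasure μ']

include heU he hPω hPΓ in
/-- **CONSUMPTION FORM.**  Let `κ` be a continuous function on `[U(1)] = relNormOneIdeles ⧸ relNormOneRat` descending the
`U(1)`-component of the twist, `κ(t̄) = η₀(1, t♭) · χ₀(1, e t)` (exists, `exists_kappa`).  Then for every `f ∈ C([U(⟨a₀⟩)])` and
every `Φ`: the MODEL lift of the twisted pull-back `(f ∘ a) · κ` vanishes iff S6's lift of `f` (against `a_* μ′`) does —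
`P.kernelDatum.thetaLift μ′ Φ ((f ∘ a) · κ) ≠ 0 ↔ (cmThetaKernelDatum … hGR₀ hρ SK hSK).thetaLift (μ′.map a) Φ f ≠ 0`, `a = cosetCongr e`.
So a non-vanishing theorem for S6's datum (e.g. ★ `thetaLift_charCM_tmul_ne_zero_of_finCoeff_ne_zero`) yields a non-vanishing
slot-0 model lift at once. [cite: Li1992, p. 178; GelbartRogawski1991, §3.1 Remark p. 457 L4–13; Howe1979, §3] -/
theorem kernelDatum_thetaLift_comp_mul_ne_zero_iff (hcont : Continuous e) (hconts : Continuous e.symm)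
    (κ : C(↥(relNormOneIdeles (↥(maximalRealSubfield L)) L) ⧸ relNormOneRat (↥(maximalRealSubfield L)) L, ℂ))
    (hκ : ∀ t : ↥(relNormOneIdeles (↥(maximalRealSubfield L)) L),
      κ (QuotientGroup.mk t) =
        ((η₀ (1, (cmAdelicOneEquivRelNormOne (L : Type)).symm t) *
            cmLineChar₀ (L : Type) finProdFinEquiv e₁ (frameD V) (frameD_real V) (frameD_ne V) (dW S) (dW_real S) (dW_ne S)
              hGR hGR₀ hGR₁ (1, e t) : ℂˣ) : ℂ))
    (Φ : piSchwartzBruhat (↥(maximalRealSubfield L)) (Fin 3))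
    (f : C(CMAdelic (L : Type) (lineVec (L : Type) (dW S 0)) ⧸ CMRat (L : Type) (lineVec (L : Type) (dW S 0)), ℂ)) :
    P.kernelDatum.thetaLift μ' (P.weilDatum.toThetaTop Φ)
        (f.comp ⟨cosetCongr e (relNormOneRat (↥(maximalRealSubfield L)) L) (CMRat (L : Type) (lineVec (L : Type) (dW S 0))) hΓ,
          continuous_cosetCongr e _ _ hΓ hcont⟩ * κ) ≠ 0 ↔
      (cmThetaKernelDatum (L : Type) e₁ (frameD V) (frameD_real V) (frameD_ne V) (lineVec (L : Type) (dW S 0))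
            (fun _ => dW_real S 0) (fun _ => dW_ne S 0) hGR₀ hρ SK hSK).thetaLift
          (μ'.map (cosetCongr e (relNormOneRat (↥(maximalRealSubfield L)) L)
            (CMRat (L : Type) (lineVec (L : Type) (dW S 0))) hΓ)) Φ f ≠ 0 := by
  obtain ⟨c, hc, hT⟩ := exists_twist_lineRepOf_zero V S hGR hGR₀ hGR₁ hGR₂ hGR₃ η₀ η₁ η₂ η₃ eU heU e he
  have hU : ∀ x : ↥(regimeSubgroup L V.Hm), eU x ∈ CMRat (L : Type) (frameD V) ↔ x ∈ P.ΓU := fun x => by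
    rw [hPΓ]; exact mem_CMRat_iff_mem_regimeRat V eU heU x
  have hωω' : ∀ (p : ↥(regimeSubgroup L V.Hm) × ↥(relNormOneIdeles (↥(maximalRealSubfield L)) L))
      (Φ : piSchwartzBruhat (↥(maximalRealSubfield L)) (Fin 3)),
      P.ω p Φ = ((c p : ℂˣ) : ℂ) • cmPairRep (L : Type) e₁ (frameD V) (frameD_real V) (frameD_ne V) (lineVec (L : Type) (dW S 0))
        (fun _ => dW_real S 0) (fun _ => dW_ne S 0) hGR₀ (eU p.1, e p.2) Φ := fun p Φ => by
    rw [hPω]; exact hT p Φ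
  have hκ' : ∀ t : ↥(relNormOneIdeles (↥(maximalRealSubfield L)) L),
      κ (QuotientGroup.mk t) = ((c (1, t) : ℂˣ) : ℂ) := fun t => by
    rw [hκ, hc]
    simp only [map_one]
  have key := thetaLift_comp_mul_ne_zero_iff_of_twist (ΓU := CMRat (L : Type) (frameD V))
    (Γ := CMRat (L : Type) (lineVec (L : Type) (dW S 0))) (ΓU' := P.ΓU)
    (Γ' := relNormOneRat (↥(maximalRealSubfield L)) L)
    (cmPairRep (L : Type) e₁ (frameD V) (frameD_real V) (frameD_ne V) (lineVec (L : Type) (dW S 0)) (fun _ => dW_real S 0)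
      (fun _ => dW_ne S 0) hGR₀)
    hρ
    (fun γU hγU γ hγ => cmPairRep_toHomUnits_mem_thetaStabilizer (L : Type) e₁ (frameD V) (frameD_real V) (frameD_ne V)
      (lineVec (L : Type) (dW S 0)) (fun _ => dW_real S 0) (fun _ => dW_ne S 0) hGR₀ hγU hγ)
    SK hSK P.ω P.majorants P.toHomUnits_mem_thetaStabilizer Set.univ (fun _ _ _ => Set.mem_univ _) eU hU e hΓ c hωω' μ'
    hcont hconts κ hκ' Φ f
  exact key

omit [MeasurableSpace (CMAdelic (L : Type) (lineVec (L : Type) (dW S 0)) ⧸ CMRat (L : Type) (lineVec (L : Type) (dW S 0)))]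
  [BorelSpace (CMAdelic (L : Type) (lineVec (L : Type) (dW S 0)) ⧸ CMRat (L : Type) (lineVec (L : Type) (dW S 0)))]
  [CompactSpace (CMAdelic (L : Type) (frameD V) ⧸ CMRat (L : Type) (frameD V))]
  [CompactSpace (CMAdelic (L : Type) (lineVec (L : Type) (dW S 0)) ⧸ CMRat (L : Type) (lineVec (L : Type) (dW S 0)))]
  [CompactSpace (↥(regimeSubgroup L V.Hm) ⧸ P.ΓU)] in
include heU he hPω hPΓ hΓ in
/-- **The multiplier `κ` exists** as soon as `t ↦ η₀(1, t♭) · χ₀(1, e t)` is continuous on `relNormOneIdeles` (at the pin: `hη₀c` of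
the side and ★ `continuous_cmLineChar₀_of_signs`, along ★ `continuous_cmLineTorusEquiv`). [cite: GelbartRogawski1991, §3.1 Remark p. 457 L4–13] -/
theorem exists_kappa
    (hc : Continuous fun t : ↥(relNormOneIdeles (↥(maximalRealSubfield L)) L) =>
      ((η₀ (1, (cmAdelicOneEquivRelNormOne (L : Type)).symm t) *
          cmLineChar₀ (L : Type) finProdFinEquiv e₁ (frameD V) (frameD_real V) (frameD_ne V) (dW S) (dW_real S) (dW_ne S)
            hGR hGR₀ hGR₁ (1, e t) : ℂˣ) : ℂ)) :
    ∃ κ : C(↥(relNormOneIdeles (↥(maximalRealSubfield L)) L) ⧸ relNormOneRat (↥(maximalRealSubfield L)) L, ℂ),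
      ∀ t : ↥(relNormOneIdeles (↥(maximalRealSubfield L)) L),
        κ (QuotientGroup.mk t) =
          ((η₀ (1, (cmAdelicOneEquivRelNormOne (L : Type)).symm t) *
              cmLineChar₀ (L : Type) finProdFinEquiv e₁ (frameD V) (frameD_real V) (frameD_ne V) (dW S) (dW_real S) (dW_ne S)
                hGR hGR₀ hGR₁ (1, e t) : ℂˣ) : ℂ) := by
  obtain ⟨c, hc', hT⟩ := exists_twist_lineRepOf_zero V S hGR hGR₀ hGR₁ hGR₂ hGR₃ η₀ η₁ η₂ η₃ eU heU e he
  have hU : ∀ x : ↥(regimeSubgroup L V.Hm), eU x ∈ CMRat (L : Type) (frameD V) ↔ x ∈ P.ΓU := fun x => by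
    rw [hPΓ]; exact mem_CMRat_iff_mem_regimeRat V eU heU x
  have hωω' : ∀ (p : ↥(regimeSubgroup L V.Hm) × ↥(relNormOneIdeles (↥(maximalRealSubfield L)) L))
      (Φ : piSchwartzBruhat (↥(maximalRealSubfield L)) (Fin 3)),
      P.ω p Φ = ((c p : ℂˣ) : ℂ) • cmPairRep (L : Type) e₁ (frameD V) (frameD_real V) (frameD_ne V) (lineVec (L : Type) (dW S 0))
        (fun _ => dW_real S 0) (fun _ => dW_ne S 0) hGR₀ (eU p.1, e p.2) Φ := fun p Φ => by
    rw [hPω]; exact hT p Φ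
  have hc1 : ∀ t : ↥(relNormOneIdeles (↥(maximalRealSubfield L)) L),
      ((c (1, t) : ℂˣ) : ℂ) =
        ((η₀ (1, (cmAdelicOneEquivRelNormOne (L : Type)).symm t) *
            cmLineChar₀ (L : Type) finProdFinEquiv e₁ (frameD V) (frameD_real V) (frameD_ne V) (dW S) (dW_real S) (dW_ne S)
              hGR hGR₀ hGR₁ (1, e t) : ℂˣ) : ℂ) := fun t => by
    rw [hc']
    simp only [map_one]
  have hcc : Continuous fun t : ↥(relNormOneIdeles (↥(maximalRealSubfield L)) L) => ((c (1, t) : ℂˣ) : ℂ) := by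
    simp_rw [hc1]; exact hc
  obtain ⟨κ, hκ⟩ := exists_twist_descend_right' (ΓU := CMRat (L : Type) (frameD V))
    (Γ := CMRat (L : Type) (lineVec (L : Type) (dW S 0))) (ΓU' := P.ΓU)
    (Γ' := relNormOneRat (↥(maximalRealSubfield L)) L)
    (cmPairRep (L : Type) e₁ (frameD V) (frameD_real V) (frameD_ne V) (lineVec (L : Type) (dW S 0)) (fun _ => dW_real S 0)
      (fun _ => dW_ne S 0) hGR₀)
    (fun γU hγU γ hγ => cmPairRep_toHomUnits_mem_thetaStabilizer (L : Type) e₁ (frameD V) (frameD_real V) (frameD_ne V)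
      (lineVec (L : Type) (dW S 0)) (fun _ => dW_real S 0) (fun _ => dW_ne S 0) hGR₀ hγU hγ)
    P.ω P.toHomUnits_mem_thetaStabilizer eU hU e hΓ c hωω' hcc
  exact ⟨κ, fun t => (hκ t).trans (hc1 t)⟩

omit η₀ η₁ η₂ η₃ eU heU he [CompactSpace (CMAdelic (L : Type) (lineVec (L : Type) (dW S 0)) ⧸ CMRat (L : Type) (lineVec (L : Type) (dW S 0)))]
  [IsFiniteMeasure μ'] in
/-- **S6's `μ`-binders for the push-forward measure**: `μ′.map (cosetCongr e)` is `U(⟨a₀⟩)(𝔸)`-INVARIANT when `μ′` is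
`U(1)(𝔸)`-invariant (★ `smulInvariantMeasure_map_cosetCongr_of_smulInvariantMeasure`). [cite: Li1992, Thm 2.1 (26) p. 184] -/
theorem smulInvariantMeasure_map_cosetCongr (hcont : Continuous e)
    [SMulInvariantMeasure (↥(relNormOneIdeles (↥(maximalRealSubfield L)) L))
      (↥(relNormOneIdeles (↥(maximalRealSubfield L)) L) ⧸ relNormOneRat (↥(maximalRealSubfield L)) L) μ'] :
    SMulInvariantMeasure (CMAdelic (L : Type) (lineVec (L : Type) (dW S 0)))
      (CMAdelic (L : Type) (lineVec (L : Type) (dW S 0)) ⧸ CMRat (L : Type) (lineVec (L : Type) (dW S 0)))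
      (μ'.map (cosetCongr e (relNormOneRat (↥(maximalRealSubfield L)) L) (CMRat (L : Type) (lineVec (L : Type) (dW S 0))) hΓ)) :=
  smulInvariantMeasure_map_cosetCongr_of_smulInvariantMeasure e _ _ hΓ hcont μ'

omit η₀ η₁ η₂ η₃ eU heU he [CompactSpace (CMAdelic (L : Type) (lineVec (L : Type) (dW S 0)) ⧸ CMRat (L : Type) (lineVec (L : Type) (dW S 0)))]
  [IsFiniteMeasure μ'] in
/-- … and OPEN-POSITIVE when `μ′` is (★ `isOpenPosMeasure_map_cosetCongr`). [cite: Li1992, Thm 2.1 (26) p. 184] -/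
theorem isOpenPosMeasure_map_cosetCongr' (hcont : Continuous e) (hconts : Continuous e.symm) [μ'.IsOpenPosMeasure] :
    (μ'.map (cosetCongr e (relNormOneRat (↥(maximalRealSubfield L)) L)
      (CMRat (L : Type) (lineVec (L : Type) (dW S 0))) hΓ)).IsOpenPosMeasure :=
  isOpenPosMeasure_map_cosetCongr e _ _ hΓ hcont hconts μ'

end Consumption

end Summit.HodgeConjecture.HodgeConjecture.Cruxes.H413.RallisTransport
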